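import Literature.Geometry.Lorentzian.KerrRadiusGradientVector
import Literature.Geometry.Lorentzian.KerrSchildTimeTranslation
import Summits.FinalStateConjecture.FinalStateConjecture.Theorems.BartnikGapSettlingGapExhaustionCylindersBendInwardOf
import HarnessLib

/-!
# `KerrBandHigherRegularity`: uniform tube radius, non-characteristic lower bound for `dr` and
# all-order bounds of the Kerr–Schild data around a Kerr radial band
(crux `GapExhaustion`, stmt-FinalStateConjecture-10808, line photon-shell-pseudoconvexity;
stub (N-2) `stub_kerrBandHigherRegularity` of the reduction of the outward Killing-extension
sweep S5 to the Ionescu–Klainerman local extension theorem in chart form)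

The chart form of the local extension theorem needs, after an affine rescaling of a near-Kerr
chart to a unit ball, ONE constant bounding finitely many derivatives of the components and of
the level function, a lower bound for `‖dr‖` at the centre, and a tube in which straight segments
stay in the smooth region. This file is the exact-Kerr half of that bookkeeping: for a
subextremal label `0 < M`, `|a| < M`, a band `r₊ < r_lo ≤ r ≤ r_hi` of the Kerr–Schild chart
(all Kerr-star times `x⁰`) and an order `n`, there are a tube radius `ρ₀ > 0`, a Lipschitz
constant `L₃ ≥ 0`, a lower bound `ν > 0` and one constant `C ≥ 0` such that at every point
`z + w`, `‖w‖ ≤ ρ₀`, of the closed `ρ₀`-tube around the band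

* the Kerr–Schild radius stays `> (r₊ + r_lo)/2` (so `g_{M,a}` and `r` are `C^∞` there,
  `Kerr.contDiffAt_bilin`, `Kerr.contDiffAt_radius`),
* `|r(z + w) − r(z)| ≤ L₃ ‖w‖` (mean value inequality along the segment, which stays in the tube),
* `‖Dr(z + w)‖ ≥ ν` (`dr ≠ 0` beyond the event horizon: `dr(♯dr) = Δ(r)/Σ > 0`,
  `Kerr.bilin_radiusGradVector_self`, `Kerr.sub_rPlus_mul_sub_rMinus_pos`),
* `‖Dʲ g_{M,a}(z + w)‖ ≤ C` and `‖Dʲ r(z + w)‖ ≤ C` for all `j ≤ n`.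

Proof (the template is the order-`2` version `stub_kerrBandRegularity` of
`BartnikGapSettlingGapExhaustionKerrBandRegularity.lean`): everything is invariant under the time
translations `x ↦ x + t ∂₀` (`Kerr.radius_add_time_smul_basisVector`, `Kerr.bilin_add_time`,
`OpensChart.fderiv_eq_of_forall_add_eq`, and `iteratedFDeriv_comp_add_right` for the iterated
derivatives), so it suffices to work over the compact time slice `K = {z⁰ = 0, r_lo ≤ r ≤ r_hi}`
(`kerrCylindersBendInward_isCompact_slice`). The open superlevel set `{r > (r₊ + r_lo)/2}`
contains `K`, hence a closed thickening `cthickening ρ₀ K` (`IsCompact.exists_cthickening_subset_open`);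
that thickening is compact (`IsCompact.cthickening`) and lies in `{r > r₊} ⊆ {r > 0}`, where all
the fields `Dʲ g_{M,a}`, `Dʲ r` are continuous (`ContDiffAt.continuousAt_iteratedFDeriv`), whence
the bounds (`IsCompact.exists_bound_of_continuousOn`, applied to the single continuous function
`∑_{j ≤ n} (‖Dʲ g‖ + ‖Dʲ r‖)`) and the positive minimum of the continuous positive function `‖Dr‖`
(`IsCompact.exists_isMinOn`).

References: R. P. Kerr, A. Schild (1965), §§2–3 [KerrSchild1965]; M. Visser, arXiv:0706.0622,
(32)–(35) [arXiv07060622]; B. O'Neill, *The geometry of Kerr black holes* (1995), §2.5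
[ONeill1995]; A. D. Ionescu, S. Klainerman, Invent. Math. 175 (2009), Def. 3.1.
-/

noncomputable section

-- instance search through the nested operator types `E4 →L[ℝ] E4 →L[ℝ] E4 →L[ℝ] ℝ`
set_option maxSynthPendingDepth 3

-- D-0017: single-problem summit, `Summit.<S>.<S>.…` by design (cf. lakefile `weak.linter.dupNamespace`).
set_option linter.dupNamespace false

namespace Summit.FinalStateConjecture.FinalStateConjecture.Theorems

open Set Literature.Geometry.Lorentzian
open scoped Manifold ContDiff Topology ENNReal

/-- Translation invariance of a function passes to all its iterated derivatives:
if `f (x + v) = f x` for all `x`, then `Dʲf (x + v) = Dʲf x` (Mathlib's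
`iteratedFDeriv_comp_add_right`). [folklore] -/
private theorem kerrBandHigher_iteratedFDeriv_eq_of_forall_add_eq {F : Type*}
    [NormedAddCommGroup F] [NormedSpace ℝ F] {f : E4 → F} {v : E4} (h : ∀ x, f (x + v) = f x)
    (j : ℕ) (x : E4) : iteratedFDeriv ℝ j f (x + v) = iteratedFDeriv ℝ j f x := by
  rw [← iteratedFDeriv_comp_add_right j v x, show (fun z ↦ f (z + v)) = f from funext h]

/-- Beyond the event horizon of a subextremal Kerr the differential of the Kerr–Schild radius
does not vanish: `dr(W) = g(W, W) = Δ(r)/Σ > 0` for the metric gradient `W = ♯dr`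
(`Kerr.radiusGradVector`), `Δ(r) = (r − r₊)(r − r₋) > 0` for `r > r₊`. O'Neill 1995, §2.5.
[cite: ONeill1995, §2.5] -/
private theorem kerrBandHigher_fderiv_radius_ne_zero {M a : ℝ} (ha : |a| < M) {z : E4}
    (hz : Kerr.rPlus M a < Kerr.radius a z) : fderiv ℝ (Kerr.radius a) z ≠ 0 := by
  have hsub : Kerr.IsSubextremal M a := ha
  have hz0 : 0 < Kerr.radius a z := hsub.rPlus_pos.trans hz
  have hpos : 0 < fderiv ℝ (Kerr.radius a) z (Kerr.radiusGradVector M a z) := by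
    rw [(Kerr.hasFDerivAt_radius_bilin (M := M) hz0).fderiv, Kerr.bilin_radiusGradVector_self hz0]
    refine div_pos ?_ (Kerr.blSigma_spatial_pos hz0)
    rw [← Kerr.sub_rPlus_mul_sub_rMinus hsub.sq_lt_sq.le]
    exact Kerr.sub_rPlus_mul_sub_rMinus_pos hz
  intro h
  rw [h] at hpos
  simp at hpos

/-- **(N-2) All-order uniform regularity of exact Kerr on a tube around a radial band (crux
`GapExhaustion`, stmt-FinalStateConjecture-10808; line photon-shell-pseudoconvexity, reduction
of the outward sweep S5 to the Ionescu–Klainerman local extension theorem).** For `0 < M`,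
`|a| < M`, a band `r₊ < r_lo ≤ r_hi` and an order `n` there are `ρ₀ > 0`, `L₃ ≥ 0`, `ν > 0`,
`C ≥ 0` such that for every point `z` of Kerr–Schild coordinate space with `r_lo ≤ r(z) ≤ r_hi`
(all times) and every `w` with `‖w‖ ≤ ρ₀`: `r(z + w) > (r₊ + r_lo)/2`,
`|r(z + w) − r(z)| ≤ L₃‖w‖`, `g_{M,a}` and `r` are `C^∞` at `z + w`, `‖Dr(z + w)‖ ≥ ν`, and
`‖Dʲ g_{M,a}(z + w)‖ ≤ C`, `‖Dʲ r(z + w)‖ ≤ C` for `j ≤ n`. Compactness of the closed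
thickening of the time slice of the band inside `{r > (r₊ + r_lo)/2}`, continuity of all
derivatives of the fields on `{r > 0}` (Kerr–Schild 1965, §3; Visser arXiv:0706.0622,
(32)–(35)), `dr(♯dr) = Δ/Σ > 0` beyond `r₊` (O'Neill 1995, §2.5), stationarity of Kerr, and the
mean value inequality. [cite: KerrSchild1965, §3] -/
theorem stub_kerrBandHigherRegularity :
    ∀ (M a r_lo r_hi : ℝ) (n : ℕ), 0 < M → |a| < M → Kerr.rPlus M a < r_lo → r_lo ≤ r_hi →
      ∃ (ρ₀ L₃ ν C : ℝ), 0 < ρ₀ ∧ 0 ≤ L₃ ∧ 0 < ν ∧ 0 ≤ C ∧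
      ∀ z : E4, r_lo ≤ Kerr.radius a z → Kerr.radius a z ≤ r_hi → ∀ w : E4, ‖w‖ ≤ ρ₀ →
        (Kerr.rPlus M a + r_lo) / 2 < Kerr.radius a (z + w) ∧
        |Kerr.radius a (z + w) - Kerr.radius a z| ≤ L₃ * ‖w‖ ∧
        ContDiffAt ℝ ∞ (Kerr.bilin M a) (z + w) ∧ ContDiffAt ℝ ∞ (Kerr.radius a) (z + w) ∧
        ν ≤ ‖fderiv ℝ (Kerr.radius a) (z + w)‖ ∧
        ∀ j : ℕ, j ≤ n →
          ‖iteratedFDeriv ℝ j (Kerr.bilin M a) (z + w)‖ ≤ C ∧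
          ‖iteratedFDeriv ℝ j (Kerr.radius a) (z + w)‖ ≤ C := by
  intro M a r_lo r_hi n _hM ha hlo _hlohi
  have hsub : Kerr.IsSubextremal M a := ha
  have hrp : 0 < Kerr.rPlus M a := hsub.rPlus_pos
  have hlo0 : 0 < r_lo := hrp.trans hlo
  -- the threshold radius of the tube, strictly between `r₊` and `r_lo`
  set r₁ : ℝ := (Kerr.rPlus M a + r_lo) / 2 with hr₁
  have hr₁p : Kerr.rPlus M a < r₁ := by rw [hr₁]; linarith
  have hr₁lo : r₁ < r_lo := by rw [hr₁]; linarith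
  have hr₁0 : 0 < r₁ := hrp.trans hr₁p
  -- the compact time slice of the band
  set K : Set E4 := {z : E4 | z 0 = 0 ∧ r_lo ≤ Kerr.radius a z ∧ Kerr.radius a z ≤ r_hi}
    with hKdef
  have hK : IsCompact K := kerrCylindersBendInward_isCompact_slice a r_hi hlo0
  -- the open superlevel set `{r > r₁}` contains the slice, hence a closed thickening of it
  set U : Set E4 := {x : E4 | r₁ < Kerr.radius a x} with hUdef
  have hU : IsOpen U := isOpen_lt continuous_const (Kerr.continuous_radius a)
  have hKU : K ⊆ U := fun z hz ↦ hr₁lo.trans_le hz.2.1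
  obtain ⟨ρ₀, hρ₀, hρ₀U⟩ := hK.exists_cthickening_subset_open hU hKU
  -- the compact tube `T = cthickening ρ₀ K ⊆ {r > r₁} ⊆ {r > 0}`
  set T : Set E4 := Metric.cthickening ρ₀ K with hTdef
  have hT : IsCompact T := hK.cthickening
  have hTr₁ : ∀ x ∈ T, r₁ < Kerr.radius a x := fun x hx ↦ hρ₀U hx
  have hTpos : ∀ x ∈ T, 0 < Kerr.radius a x := fun x hx ↦ hr₁0.trans (hTr₁ x hx)
  -- continuity on the tube of `Dr` and of all the iterated derivatives of `g_{M,a}` and `r`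
  have hc₃ : ContinuousOn (fderiv ℝ (Kerr.radius a)) T := fun x hx ↦
    ((Kerr.contDiffAt_radius (hTpos x hx) (n := 2)).fderiv_right (m := 1)
      (by norm_num)).continuousAt.continuousWithinAt
  have hcb : ∀ j : ℕ, ContinuousOn (iteratedFDeriv ℝ j (Kerr.bilin M a)) T := fun j x hx ↦
    ((Kerr.contDiffAt_bilin M a (hTpos x hx) (n := ∞)).continuousAt_iteratedFDeriv
      (by exact_mod_cast le_top)).continuousWithinAt
  have hcr : ∀ j : ℕ, ContinuousOn (iteratedFDeriv ℝ j (Kerr.radius a)) T := fun j x hx ↦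
    ((Kerr.contDiffAt_radius (hTpos x hx) (n := ∞)).continuousAt_iteratedFDeriv
      (by exact_mod_cast le_top)).continuousWithinAt
  -- the bound of `Dr` (the Lipschitz constant of `r`)
  obtain ⟨C₃, hC₃⟩ := hT.exists_bound_of_continuousOn hc₃
  -- one bound for all the derivatives of order `≤ n`, through the continuous sum of their norms
  set Φ : E4 → ℝ := fun x ↦ ∑ j ∈ Finset.range (n + 1),
    (‖iteratedFDeriv ℝ j (Kerr.bilin M a) x‖ + ‖iteratedFDeriv ℝ j (Kerr.radius a) x‖) with hΦ
  have hΦc : ContinuousOn Φ T :=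
    continuousOn_finsetSum _ fun j _ ↦ (hcb j).norm.add (hcr j).norm
  obtain ⟨C, hC⟩ := hT.exists_bound_of_continuousOn hΦc
  have hΦle : ∀ x ∈ T, ∀ j : ℕ, j ≤ n →
      ‖iteratedFDeriv ℝ j (Kerr.bilin M a) x‖ ≤ max C 0 ∧
      ‖iteratedFDeriv ℝ j (Kerr.radius a) x‖ ≤ max C 0 := by
    intro x hx j hj
    have hjmem : j ∈ Finset.range (n + 1) := Finset.mem_range.2 (Nat.lt_succ_of_le hj)
    have hsum : ‖iteratedFDeriv ℝ j (Kerr.bilin M a) x‖ + ‖iteratedFDeriv ℝ j (Kerr.radius a) x‖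
        ≤ Φ x :=
      Finset.single_le_sum (f := fun j ↦
        ‖iteratedFDeriv ℝ j (Kerr.bilin M a) x‖ + ‖iteratedFDeriv ℝ j (Kerr.radius a) x‖)
        (fun i _ ↦ add_nonneg (norm_nonneg _) (norm_nonneg _)) hjmem
    have hΦC : Φ x ≤ max C 0 := (Real.le_norm_self _).trans ((hC x hx).trans (le_max_left _ _))
    exact ⟨(le_add_of_nonneg_right (norm_nonneg _)).trans (hsum.trans hΦC),
      (le_add_of_nonneg_left (norm_nonneg _)).trans (hsum.trans hΦC)⟩
  -- the positive lower bound of `‖Dr‖` on the tube (`Dr ≠ 0` beyond `r₊`)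
  obtain ⟨ν, hν, hνT⟩ : ∃ ν : ℝ, 0 < ν ∧ ∀ x ∈ T, ν ≤ ‖fderiv ℝ (Kerr.radius a) x‖ := by
    by_cases hne : T.Nonempty
    · obtain ⟨x₀, hx₀, hmin⟩ := hT.exists_isMinOn hne hc₃.norm
      exact ⟨‖fderiv ℝ (Kerr.radius a) x₀‖,
        norm_pos_iff.2 (kerrBandHigher_fderiv_radius_ne_zero ha (hr₁p.trans (hTr₁ x₀ hx₀))),
        fun x hx ↦ hmin hx⟩
    · exact ⟨1, one_pos, fun x hx ↦ absurd ⟨x, hx⟩ hne⟩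
  refine ⟨ρ₀, max C₃ 0, ν, max C 0, hρ₀, le_max_right _ _, hν, le_max_right _ _, ?_⟩
  intro z hzlo hzhi
  -- translate `z` to the time slice: `z = z' + t ∂₀`, `t = z⁰`
  set t : ℝ := z 0 with ht
  set z' : E4 := z + (-t) • E4.basisVector 0 with hz'
  have hzz' : ∀ w : E4, z + w = (z' + w) + t • E4.basisVector 0 := fun w ↦ by
    rw [hz', neg_smul]; abel
  have hz'0 : z' 0 = 0 := by simp [hz', ht, E4.basisVector]
  have hrad' : Kerr.radius a z' = Kerr.radius a z :=
    Kerr.radius_add_time_smul_basisVector a z (-t)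
  clear_value t z'
  have hz'K : z' ∈ K := ⟨hz'0, hrad' ▸ hzlo, hrad' ▸ hzhi⟩
  -- the points `z' + w`, `‖w‖ ≤ ρ₀`, lie in the tube
  have hmemT : ∀ w : E4, ‖w‖ ≤ ρ₀ → z' + w ∈ T := fun w hw ↦
    Metric.mem_cthickening_of_dist_le (z' + w) z' ρ₀ K hz'K (by simpa [dist_eq_norm] using hw)
  -- stationarity of Kerr: the radius, its derivative and all the iterated derivatives of the
  -- components and of the radius at `z + w` are those at `z' + w`
  have hradd : ∀ x : E4, Kerr.radius a (x + t • E4.basisVector 0) = Kerr.radius a x :=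
    fun x ↦ Kerr.radius_add_time_smul_basisVector a x t
  have hradT : ∀ w : E4, Kerr.radius a (z + w) = Kerr.radius a (z' + w) := fun w ↦ by
    rw [hzz' w, hradd]
  have hfdradT : ∀ w : E4, fderiv ℝ (Kerr.radius a) (z + w) =
      fderiv ℝ (Kerr.radius a) (z' + w) := fun w ↦ by
    rw [hzz' w]
    exact OpensChart.fderiv_eq_of_forall_add_eq hradd _
  have hitbT : ∀ (j : ℕ) (w : E4), iteratedFDeriv ℝ j (Kerr.bilin M a) (z + w) =
      iteratedFDeriv ℝ j (Kerr.bilin M a) (z' + w) := fun j w ↦ by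
    rw [hzz' w]
    exact kerrBandHigher_iteratedFDeriv_eq_of_forall_add_eq (Kerr.bilin_add_time M a t) j _
  have hitrT : ∀ (j : ℕ) (w : E4), iteratedFDeriv ℝ j (Kerr.radius a) (z + w) =
      iteratedFDeriv ℝ j (Kerr.radius a) (z' + w) := fun j w ↦ by
    rw [hzz' w]
    exact kerrBandHigher_iteratedFDeriv_eq_of_forall_add_eq hradd j _
  -- the two facts used along segments: lower radius bound and gradient bound in the tube
  have hstep : ∀ w : E4, ‖w‖ ≤ ρ₀ →
      r₁ < Kerr.radius a (z + w) ∧ ‖fderiv ℝ (Kerr.radius a) (z + w)‖ ≤ max C₃ 0 := by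
    intro w hw
    refine ⟨?_, ?_⟩
    · rw [hradT]
      exact hTr₁ _ (hmemT w hw)
    · rw [hfdradT]
      exact (hC₃ _ (hmemT w hw)).trans (le_max_left _ _)
  intro w hw
  obtain ⟨hr, hdr⟩ := hstep w hw
  have hpos : 0 < Kerr.radius a (z + w) := hr₁0.trans hr
  refine ⟨hr, ?_, Kerr.contDiffAt_bilin M a hpos, Kerr.contDiffAt_radius hpos, ?_, ?_⟩
  · -- mean value inequality on the convex closed ball `closedBall z ρ₀ ⊆` tube
    have hball : ∀ x ∈ Metric.closedBall z ρ₀, ‖x - z‖ ≤ ρ₀ := fun x hx ↦ by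
      rwa [Metric.mem_closedBall, dist_eq_norm] at hx
    have hmvt := Convex.norm_image_sub_le_of_norm_fderiv_le (𝕜 := ℝ) (f := Kerr.radius a)
      (s := Metric.closedBall z ρ₀) (C := max C₃ 0) (x := z) (y := z + w)
      (fun x hx ↦ by
        have h := (hstep (x - z) (hball x hx)).1
        rw [add_sub_cancel] at h
        exact (Kerr.contDiffAt_radius (hr₁0.trans h) (n := 1)).differentiableAt one_ne_zero)
      (fun x hx ↦ by
        have h := (hstep (x - z) (hball x hx)).2
        rwa [add_sub_cancel] at h)
      (convex_closedBall z ρ₀) (Metric.mem_closedBall_self hρ₀.le)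
      (by rwa [Metric.mem_closedBall, dist_eq_norm, add_sub_cancel_left])
    rwa [Real.norm_eq_abs, add_sub_cancel_left] at hmvt
  · rw [hfdradT]
    exact hνT _ (hmemT w hw)
  · intro j hj
    rw [hitbT, hitrT]
    exact hΦle _ (hmemT w hw) j hj

end Summit.FinalStateConjecture.FinalStateConjecture.Theorems

end
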